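/-
Copyright: statement-level skeleton of a published paper (lit-balaban cell, Phase-2 proof seat p18, gen 7). No claims beyond
what the kernel checks below.
-/
import Mathlib
import Literature.MathematicalPhysics.QuantumFieldTheory.Balaban1983to89.B3Prop21Except24

/-!
# B3 — T. Bałaban, *(Higgs)₂,₃ quantum fields in a finite volume. III. Renormalization*, CMP **88** (1983) 411–445
[Balaban1983Higgs3] — Proposition 2.2 p. 428: the generalized graphs with LINES OF ARBITRARY DIMENSIONS — the free line
exponent `κ_l`, the degrees (2.2) of their blocks, and the uniform lower bound of the positive degrees for a finite menu of
line dimensions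

statement-level skeleton of published theorems with citation tags; proofs where landed; nothing here is a claim about
the Yang–Mills mass gap

PDF held: `paper:balaban1983-higgs-2-3-quantum-fields-finite-volume` (journal page = PDF page + 410); p. 428 [PDF 18] read
on the materialised text (`lit read … --pages 18`), pp. 436–437 [PDF 26–27] for the use of the generalization in Sect. 3.

Part of the Phase-2 work on SKELETON row **B3.Prop2.2** (unit `lit-balaban-p18` gen 7, HOME `run/shared/lean/pub/lit-balaban/`;
the fold owner's closing item of ROWS-B3 v1.53: *"add a free line exponent to `Counts`/`Amp` … then this head flips too"*):
files `B3FreeLineDegrees` (this file) → `B3FreeLineAmplitude` → `B3FreeLineIBP` → `B3FreeLineFamily` → `B3Prop22FreeLines`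
(the theorem `prop22_freeLines : B3Prop1.Prop22 (famK P mbar)`), sub-namespace `…Balaban1983to89.B3FreeLine`; built on seat
p19's chain `B3Ineq215*` / `B3Ineq213*` / `B3AmpIBP*` / `B3IBP*` / `B3Prop21Except24*` WITHOUT editing it.

WHAT IS REPRODUCED.  p. 428 [PDF 18], verbatim: *"It is easily seen from the proof that the theorem can be generalized to a
much wider class of graphs and expressions. We can have vertices with an arbitrary number of legs and arbitrary power of η.
We can have lines with the same exponential factors but with arbitrary dimensions instead of −d+2. The only thing which
matters is that propagators have representations corresponding to (2.6) with the estimates corresponding to (2.10)–(2.12), so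
that we have the inequality (2.13) with the proper generalization of (2.14). We can formulate these remarks as the theorem:
Proposition 2.2. Proposition 2.1 holds for the described above generalized expressions and graphs."*; and the way the
generalization is USED, p. 436 [PDF 26]: *"the factor |x − x′|^{1+α} adds to the degree of the graph the number 1 + α, thus
the degree of the expression is equal to −d + 3 + α now"*, p. 437: *"This estimate shows that for (3.12) we have exactly the
same factors as in the expression (2.14), but with different degrees; thus we have the generalized expressions and generalized
graphs in the sense explained before Proposition 2.2."*  In seat p19's count data (`B3Ineq215.Counts`: differentiations,
averaged vector legs, η-powers — the vertex side is already fully general) the dimension of a line is `−(d−2)` shifted by its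
derivative / averaged-leg structure only (`Counts.lineDim`).  KERNEL-CHECKED HERE: the generalized graph
**`Counts.toModelK G κ`** of a count datum `G` and a FREE EXTRA LINE EXPONENT `κ : Fin m → ℚ` (the line `l` has dimension
`lineDim l + κ_l`, *"arbitrary dimensions instead of −d+2"*; everything else — endpoints, η-powers, `d`, `L`, `δ₀ = ½δ₁` —
as in `Counts.toModel`, so that p19's Model-generic (2.13) `Amp.abs_E_le`, (2.15) `Model.ineq215_of_pos` and the kernel budget
`KBudget` apply by name); its blocks are those of `G` (`rep/reps/fiber/before_toModelK`); **the degrees (2.2) of its blocks**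
`D_K = D + Σ_{lines of the block} κ_l` (`D_toModelK`, ℚ-valued `degQK` with `cast_degQK` — r15's carrier degrees are
ℚ-valued); the exceptional block **(2.4) of a generalized graph** (`Is24K`: a (2.4)-block of the count datum whose line carries
no extra dimension — the graph (2.4) has the standard scalar line); and the input of *"O(1) depends on n̄"* for the generalized
graphs: for `κ_l` taken from a FINITE MENU `T ⊂ ℚ` of extra dimensions (Sect. 3 uses `1+α`, `α`, …), every positive block
degree is at least **`Dmin T m > 0`** (`Dmin_le_DK_of_pos`: the degrees are half-integers plus menu sums, `minPos_le`), whence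
**the constant of (2.15) is uniform**, `const215 ≤ unifConst215K d L m δ₁ (Dmin T m)` (`const215K_le`).  Finally the degrees
of the graphs `G′∗` of the integration by parts (2.8)/(2.9) (p19's `moveCounts`) over the generalized model: they do not
decrease and the (2.4)-blocks gain `+1` (`DK_moveCounts_ge`), so that under the printed hypothesis of Proposition 2.1 read with
`Is24K` all blocks of every `G′∗` have positive degree (`posK_moveCounts`).  HONEST SCOPE: the menu `T` is a parameter of the
family (like the kernel constants `Cmax`): with unrestricted real dimensions no single O(1) exists, since the sum (2.15)
diverges as a block degree tends to `0`; the print's "arbitrary dimensions" is read as "any fixed finite set of dimensions".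
-/

open Finset

namespace Literature.MathematicalPhysics.QuantumFieldTheory.Balaban1983to89

/-! ## The generalized graph of a count datum with free extra line exponents -/

namespace B3Ineq215.Counts

variable {V : Type} [Fintype V] [DecidableEq V] {m : ℕ} (G : Counts V m)

/-- **The generalized graph of Proposition 2.2** attached to the count datum `G` and the extra line exponents `κ`: the line
`l` has dimension `a_l = lineDim l + κ_l` (*"lines with the same exponential factors but with arbitrary dimensions instead of
−d+2"*); endpoints, η-powers, `d`, `L`, `δ₀ = ½δ₁` as in `Counts.toModel`. [cite: Balaban1983Higgs3, Prop. 2.2 p.428] -/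
noncomputable def toModelK (κ : Fin m → ℚ) : Model V m :=
  { G.toModel with a := fun l => G.lineDim l + ((κ l : ℚ) : ℝ) }

end B3Ineq215.Counts

namespace B3FreeLine

open B3Ineq215 B3Ineq213

variable {V : Type} [Fintype V] [DecidableEq V] {m : ℕ}

section Model

variable (G : Counts V m) (κ : Fin m → ℚ)

/-- The line dimensions of the generalized graph. [cite: Balaban1983Higgs3, Prop. 2.2 p.428] -/
theorem toModelK_a (l : Fin m) : (G.toModelK κ).a l = G.toModel.a l + ((κ l : ℚ) : ℝ) := rfl

/-- With no extra exponent the generalized graph is p19's `Counts.toModel`. [cite: Balaban1983Higgs3, Prop. 2.2 p.428] -/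
theorem toModelK_zero : G.toModelK (fun _ => 0) = G.toModel := by
  unfold Counts.toModelK
  simp only [Rat.cast_zero, add_zero]
  rfl

/-- Same endpoints: first endpoints. [cite: Balaban1983Higgs3, Prop. 2.2 p.428] -/
theorem toModelK_src : (G.toModelK κ).src = G.toModel.src := rfl

/-- Same endpoints: second endpoints. [cite: Balaban1983Higgs3, Prop. 2.2 p.428] -/
theorem toModelK_tgt : (G.toModelK κ).tgt = G.toModel.tgt := rfl

/-- Same η-powers. [cite: Balaban1983Higgs3, Prop. 2.2 p.428] -/
theorem toModelK_e : (G.toModelK κ).e = G.toModel.e := rfl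

/-- Same dimension `d`. [cite: Balaban1983Higgs3, Prop. 2.2 p.428] -/
theorem toModelK_d : (G.toModelK κ).d = G.toModel.d := rfl

/-- Same block size `L`. [cite: Balaban1983Higgs3, Prop. 2.2 p.428] -/
theorem toModelK_L : (G.toModelK κ).L = G.toModel.L := rfl

/-- Same decay rate `δ₀ = ½δ₁` (*"the same exponential factors"*). [cite: Balaban1983Higgs3, Prop. 2.2 p.428] -/
theorem toModelK_δ₀ : (G.toModelK κ).δ₀ = G.δ₁ / 2 := rfl

/-- Same scales `L^tη`. [cite: Balaban1983Higgs3, (2.10) p.426] -/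
theorem toModelK_sc (k t : ℕ) : (G.toModelK κ).sc k t = G.toModel.sc k t := rfl

/-- The blocks `G_i` depend on the endpoints only: same representatives map. [cite: Balaban1983Higgs3, (2.16) p.428] -/
theorem rep_toModelK (i : ℕ) : (G.toModelK κ).rep i = G.toModel.rep i :=
  rep_congr (M := G.toModelK κ) (M' := G.toModel) rfl rfl i

/-- Same set of block representatives. [cite: Balaban1983Higgs3, (2.16) p.428] -/
theorem reps_toModelK (i : ℕ) : (G.toModelK κ).reps i = G.toModel.reps i := by
  unfold Model.reps; rw [rep_toModelK]

/-- Same blocks: vertices. [cite: Balaban1983Higgs3, (2.16) p.428] -/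
theorem fiber_toModelK (i : ℕ) (b : V) : (G.toModelK κ).fiber i b = G.toModel.fiber i b := by
  unfold Model.fiber; rw [rep_toModelK]

/-- Same blocks: lines. [cite: Balaban1983Higgs3, (2.16) p.428] -/
theorem before_toModelK (i : ℕ) (b : V) : (G.toModelK κ).before i b = G.toModel.before i b := by
  unfold Model.before; rw [rep_toModelK]; rfl

/-- Same non-trivial blocks (components). [cite: Balaban1983Higgs3, (2.16) p.428] -/
theorem nontriv_toModelK (i : ℕ) (b : V) : (G.toModelK κ).Nontriv i b ↔ G.toModel.Nontriv i b := by
  unfold Model.Nontriv; rw [before_toModelK]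

/-- **The degree (2.2) of a block of the generalized graph**: `D_K(b) = D(b) + Σ_{l ∈ lines of b} κ_l` — each line of
dimension `a_l + κ_l` instead of `a_l`. [cite: Balaban1983Higgs3, (2.2) p.423] -/
theorem D_toModelK (i : ℕ) (b : V) :
    (G.toModelK κ).D i b = G.toModel.D i b + ∑ l ∈ G.toModel.before i b, ((κ l : ℚ) : ℝ) := by
  have hD : ∀ (M : Model V m), M.D i b = (∑ v ∈ M.fiber i b, ((M.d : ℝ) + M.e v)) - M.d + ∑ l ∈ M.before i b, M.a l :=
    fun _ => rfl
  rw [hD, hD, fiber_toModelK, before_toModelK]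
  simp only [toModelK_a, toModelK_d, toModelK_e, sum_add_distrib]
  ring

/-- The ℚ-valued degree (2.2) of a block of the generalized graph (r15's carrier degrees are ℚ-valued):
`degQ + Σ_{lines of the block} κ_l`. [cite: Balaban1983Higgs3, (2.2) p.423] -/
noncomputable def degQK (i : ℕ) (b : V) : ℚ := degQ G i b + ∑ l ∈ G.toModel.before i b, κ l

/-- `degQK` casts to the ℝ-valued degree of the generalized model. [cite: Balaban1983Higgs3, (2.2) p.423] -/
theorem cast_degQK (i : ℕ) (b : V) : ((degQK G κ i b : ℚ) : ℝ) = (G.toModelK κ).D i b := by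
  unfold degQK
  rw [D_toModelK, Rat.cast_add, cast_degQ, Rat.cast_sum]

/-- **The block (2.4) of a generalized graph**: a (2.4)-block of the count datum (p19's `Is24Block`: one line of (2.4)-shape,
degree `0`) whose line carries NO extra dimension — the graph (2.4) p. 424 has the standard scalar line of dimension `−d+2`.
[cite: Balaban1983Higgs3, (2.4) p.424] -/
def Is24K (i : ℕ) (b : V) : Prop := Is24Block G i b ∧ ∀ l ∈ G.toModel.before i b, κ l = 0

/-- A (2.4)-block of a generalized graph has degree `0`. [cite: Balaban1983Higgs3, (2.4) p.424] -/
theorem Is24K.D_eq_zero {G : Counts V m} {κ : Fin m → ℚ} {i : ℕ} {b : V} (h : Is24K G κ i b) :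
    (G.toModelK κ).D i b = 0 := by
  rw [D_toModelK, ← cast_degQ, h.1.1, sum_eq_zero (fun l hl => by rw [h.2 l hl, Rat.cast_zero])]
  simp

end Model

/-! ## Positive degrees are bounded below: half-integers plus a finite menu of extra dimensions -/

section Menu

/-- The least positive value of `n/2 + s` over the integers `n`: `½` if `2s` is an integer, the fractional part of `2s`
halved otherwise. [cite: Balaban1983Higgs3, (2.16) p.428] -/
noncomputable def minPos (s : ℚ) : ℚ := if Int.fract (2 * s) = 0 then 1 / 2 else Int.fract (2 * s) / 2

/-- `minPos s > 0`. [cite: Balaban1983Higgs3, (2.16) p.428] -/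
theorem minPos_pos (s : ℚ) : 0 < minPos s := by
  unfold minPos
  split_ifs with h
  · norm_num
  · exact div_pos (lt_of_le_of_ne (Int.fract_nonneg _) (Ne.symm h)) two_pos

/-- `minPos s ≤ ½`. [cite: Balaban1983Higgs3, (2.16) p.428] -/
theorem minPos_le_half (s : ℚ) : minPos s ≤ 1 / 2 := by
  unfold minPos
  split_ifs with h
  · exact le_rfl
  · have := Int.fract_lt_one (2 * s)
    linarith

/-- **A positive half-integer-plus-`s` is at least `minPos s`.** [cite: Balaban1983Higgs3, (2.16) p.428] -/
theorem minPos_le {s : ℚ} {n : ℤ} (h : 0 < (n : ℚ) / 2 + s) : minPos s ≤ (n : ℚ) / 2 + s := by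
  set t : ℚ := (n : ℚ) / 2 + s with ht
  have h2t : 2 * t = (n : ℚ) + 2 * s := by rw [ht]; ring
  have hfr : Int.fract (2 * t) = Int.fract (2 * s) := by rw [h2t, Int.fract_intCast_add]
  have hdec : ((⌊2 * t⌋ : ℤ) : ℚ) + Int.fract (2 * t) = 2 * t := Int.floor_add_fract (2 * t)
  have hfl : (0 : ℤ) ≤ ⌊2 * t⌋ := Int.floor_nonneg.2 (by linarith)
  unfold minPos
  split_ifs with h0
  · -- `2t` is a positive integer
    rw [h0] at hfr
    have hint : ((⌊2 * t⌋ : ℤ) : ℚ) = 2 * t := by rw [hfr, add_zero] at hdec; exact hdec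
    have hpos : (0 : ℚ) < ((⌊2 * t⌋ : ℤ) : ℚ) := by rw [hint]; linarith
    have h0' : (0 : ℤ) < ⌊2 * t⌋ := by exact_mod_cast hpos
    have h1 : (1 : ℤ) ≤ ⌊2 * t⌋ := by omega
    have h1' : (1 : ℚ) ≤ ((⌊2 * t⌋ : ℤ) : ℚ) := by exact_mod_cast h1
    linarith
  · have hfl' : (0 : ℚ) ≤ ((⌊2 * t⌋ : ℤ) : ℚ) := by exact_mod_cast hfl
    rw [← hfr]
    linarith

variable (T : Finset ℚ) (m : ℕ)

/-- The sums `Σ_{l ∈ B} κ_l` of menu-valued extra exponents over sets of lines `B`. [cite: Balaban1983Higgs3, (2.16) p.428] -/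
noncomputable def menuSums : Finset ℚ :=
  ((Fintype.piFinset fun _ : Fin m => T) ×ˢ (univ : Finset (Finset (Fin m)))).image fun p => ∑ l ∈ p.2, p.1 l

/-- A menu sum is in `menuSums`. [cite: Balaban1983Higgs3, (2.16) p.428] -/
theorem mem_menuSums {κ : Fin m → ℚ} (hκ : ∀ l, κ l ∈ T) (B : Finset (Fin m)) : ∑ l ∈ B, κ l ∈ menuSums T m :=
  mem_image.2 ⟨(κ, B), mem_product.2 ⟨Fintype.mem_piFinset.2 hκ, mem_univ _⟩, rfl⟩

/-- **The uniform lower bound of the positive block degrees** of the generalized graphs with at most/exactly `m` lines and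
extra exponents from the menu `T`: the least `minPos` of a menu sum (and at most `½`). [cite: Balaban1983Higgs3, (2.16) p.428] -/
noncomputable def Dmin : ℚ := (insert (1 / 2 : ℚ) ((menuSums T m).image minPos)).min' (insert_nonempty _ _)

/-- `Dmin ≤ ½`. [cite: Balaban1983Higgs3, (2.16) p.428] -/
theorem Dmin_le_half : Dmin T m ≤ 1 / 2 := min'_le _ _ (mem_insert_self _ _)

/-- `Dmin > 0`. [cite: Balaban1983Higgs3, (2.16) p.428] -/
theorem Dmin_pos : 0 < Dmin T m := by
  unfold Dmin
  apply (lt_min'_iff _ _).2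
  intro y hy
  rcases mem_insert.1 hy with rfl | hy
  · norm_num
  · obtain ⟨s, -, rfl⟩ := mem_image.1 hy
    exact minPos_pos s

/-- `Dmin` is below the `minPos` of every menu sum. [cite: Balaban1983Higgs3, (2.16) p.428] -/
theorem Dmin_le_minPos {κ : Fin m → ℚ} (hκ : ∀ l, κ l ∈ T) (B : Finset (Fin m)) : Dmin T m ≤ minPos (∑ l ∈ B, κ l) :=
  min'_le _ _ (mem_insert_of_mem (mem_image_of_mem _ (mem_menuSums T m hκ B)))

/-- **A positive half-integer plus a menu sum is at least `Dmin`.** [cite: Balaban1983Higgs3, (2.16) p.428] -/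
theorem Dmin_le_of_pos {κ : Fin m → ℚ} (hκ : ∀ l, κ l ∈ T) (B : Finset (Fin m)) {n : ℤ}
    (h : 0 < (n : ℚ) / 2 + ∑ l ∈ B, κ l) : Dmin T m ≤ (n : ℚ) / 2 + ∑ l ∈ B, κ l :=
  (Dmin_le_minPos T m hκ B).trans (minPos_le h)

end Menu

section Degrees

variable (G : Counts V m) {T : Finset ℚ} {κ : Fin m → ℚ}

/-- **A positive block degree of a generalized graph with menu-valued extra exponents is at least `Dmin T m`** (the count
datum's degree is a half-integer, p19's `two_mul_degQ_eq_intCast`). [cite: Balaban1983Higgs3, (2.2) p.423] -/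
theorem Dmin_le_DK_of_pos (hκ : ∀ l, κ l ∈ T) (i : ℕ) (b : V) (h : 0 < (G.toModelK κ).D i b) :
    ((Dmin T m : ℚ) : ℝ) ≤ (G.toModelK κ).D i b := by
  rw [← cast_degQK] at h ⊢
  have hq : 0 < degQK G κ i b := by exact_mod_cast h
  have h2 : degQ G i b = (twoDegZ G i b : ℚ) / 2 := by
    have := two_mul_degQ_eq_intCast G i b
    linarith
  have hq' : 0 < (twoDegZ G i b : ℚ) / 2 + ∑ l ∈ G.toModel.before i b, κ l := by
    unfold degQK at hq; rwa [h2] at hq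
  have hle := Dmin_le_of_pos T m hκ (G.toModel.before i b) hq'
  have : degQK G κ i b = (twoDegZ G i b : ℚ) / 2 + ∑ l ∈ G.toModel.before i b, κ l := by unfold degQK; rw [h2]
  rw [this]
  exact_mod_cast hle

/-- If every component of `G_{i+1}` has positive degree then `Σ_α D_K(G_{i+1}^{(α)}) ≥ Dmin` (the component containing
l(i+1) contributes `≥ Dmin`, the others are positive). [cite: Balaban1983Higgs3, (2.16) p.428] -/
theorem Dmin_le_Dsum_succ (hκ : ∀ l, κ l ∈ T) {i : ℕ} (h : i < m)
    (hpos : ∀ b ∈ (G.toModelK κ).reps (i + 1), (G.toModelK κ).Nontriv (i + 1) b → 0 < (G.toModelK κ).D (i + 1) b) :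
    ((Dmin T m : ℚ) : ℝ) ≤ (G.toModelK κ).Dsum (i + 1) := by
  set M := G.toModelK κ
  unfold Model.Dsum
  have hbs : M.bs i h ∈ (M.reps (i + 1)).filter (fun b => M.Nontriv (i + 1) b) :=
    mem_filter.2 ⟨M.bs_mem_reps_succ h, M.nontriv_succ_bs h⟩
  calc ((Dmin T m : ℚ) : ℝ) ≤ M.D (i + 1) (M.bs i h) :=
        Dmin_le_DK_of_pos G hκ (i + 1) _ (hpos _ (M.bs_mem_reps_succ h) (M.nontriv_succ_bs h))
    _ ≤ ∑ b ∈ (M.reps (i + 1)).filter (fun b => M.Nontriv (i + 1) b), M.D (i + 1) b :=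
        single_le_sum (f := fun b => M.D (i + 1) b) (fun b hb => (hpos b (mem_filter.1 hb).1 (mem_filter.1 hb).2).le) hbs

end Degrees

/-! ## The constant of (2.15) for the generalized graphs, uniformly in the graph -/

section Uniform

/-- The uniform constant of (2.15) for the generalized graphs: `Π_{i<m} e^{½δ₁}K(½δ₁/(2m+1)^{i+1}, d) · ((1 − L^{−Dm})^{−1})^m`,
`Dm` the lower bound of the positive block degrees — a function of `m`, `d`, `L`, `δ₁`, `Dm` only (*"O(1) depends on δ_i, n̄
only"*, p. 428). [cite: Balaban1983Higgs3, (2.16) p.428] -/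
noncomputable def unifConst215K (d L m : ℕ) (δ₁ Dm : ℝ) : ℝ :=
  (∏ i ∈ range m, Real.exp (δ₁ / 2) * Cube.Kdec (δ₁ / 2 / (2 * m + 1) ^ (i + 1)) d) * ((1 - (L : ℝ) ^ (-Dm))⁻¹) ^ m

/-- For `L ≥ 2`, `Dm > 0`: `0 < 1 − L^{−Dm}`. [cite: Balaban1983Higgs3, (2.16) p.428] -/
theorem one_sub_rpow_neg_pos {L : ℕ} (hL : 2 ≤ L) {Dm : ℝ} (hD : 0 < Dm) : 0 < 1 - (L : ℝ) ^ (-Dm) := by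
  have hL1 : (1 : ℝ) < L := by exact_mod_cast lt_of_lt_of_le one_lt_two hL
  have : (L : ℝ) ^ (-Dm) < 1 := Real.rpow_lt_one_of_one_lt_of_neg hL1 (by linarith)
  linarith

/-- The uniform constant is positive. [cite: Balaban1983Higgs3, (2.16) p.428] -/
theorem unifConst215K_pos {d L : ℕ} (hd : 0 < d) (hL : 2 ≤ L) (m : ℕ) {δ₁ Dm : ℝ} (hδ : 0 < δ₁) (hD : 0 < Dm) :
    0 < unifConst215K d L m δ₁ Dm := by
  unfold unifConst215K
  refine mul_pos (prod_pos fun i _ => mul_pos (Real.exp_pos _) (Cube.Kdec_pos ?_ hd)) ?_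
  · have : (0 : ℝ) < (2 * m + 1 : ℝ) ^ (i + 1) := by positivity
    exact div_pos (half_pos hδ) this
  · exact pow_pos (inv_pos.2 (one_sub_rpow_neg_pos hL hD)) _

variable (G : Counts V m) {T : Finset ℚ} {κ : Fin m → ℚ}

/-- The first factor of `const215` of the generalized graph IS the first factor of the uniform constant (the exponential
factors are the same). [cite: Balaban1983Higgs3, (2.15) p.427] -/
theorem prod_Kst_eqK (κ : Fin m → ℚ) : ∏ i ∈ range m, (G.toModelK κ).Kst i
    = ∏ i ∈ range m, Real.exp (G.δ₁ / 2) * Cube.Kdec (G.δ₁ / 2 / (2 * m + 1) ^ (i + 1)) G.d :=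
  rfl

/-- Under `Σ_α D_K(G_{i+1}^{(α)}) ≥ Dm` the ratio of (2.16) is at most `L^{−Dm}`. [cite: Balaban1983Higgs3, (2.16) p.428] -/
theorem rho215_leK (κ : Fin m → ℚ) {i : ℕ} {Dm : ℝ} (h : Dm ≤ (G.toModelK κ).Dsum (i + 1)) :
    (G.toModelK κ).rho215 i ≤ (G.L : ℝ) ^ (-Dm) := by
  unfold Model.rho215
  exact Real.rpow_le_rpow_of_exponent_le (G.toModelK κ).one_lt_L.le (by linarith)

/-- **The constant of (2.15) is uniform over the generalized graphs with menu-valued extra exponents**: if every component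
of every `G_i` has positive degree, then `const215 ≤ unifConst215K d L m δ₁ (Dmin T m)`. [cite: Balaban1983Higgs3, (2.16) p.428] -/
theorem const215K_le (hκ : ∀ l, κ l ∈ T)
    (hpos : ∀ i, i ≤ m → ∀ b ∈ (G.toModelK κ).reps i, (G.toModelK κ).Nontriv i b → 0 < (G.toModelK κ).D i b) :
    (G.toModelK κ).const215 ≤ unifConst215K G.d G.L m G.δ₁ ((Dmin T m : ℚ) : ℝ) := by
  set M := G.toModelK κ
  have hDm : (0 : ℝ) < ((Dmin T m : ℚ) : ℝ) := by exact_mod_cast Dmin_pos T m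
  unfold Model.const215 unifConst215K
  rw [prod_Kst_eqK]
  have hq : 0 < 1 - (G.L : ℝ) ^ (-((Dmin T m : ℚ) : ℝ)) := one_sub_rpow_neg_pos G.two_le_L hDm
  have hK : 0 ≤ ∏ i ∈ range m, Real.exp (G.δ₁ / 2) * Cube.Kdec (G.δ₁ / 2 / (2 * m + 1) ^ (i + 1)) G.d := by
    rw [← prod_Kst_eqK G κ]
    exact prod_nonneg fun i _ => (M.Kst_pos i).le
  refine mul_le_mul_of_nonneg_left ?_ hK
  calc ∏ i ∈ range m, (1 - M.rho215 i)⁻¹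
      ≤ ∏ _i ∈ range m, (1 - (G.L : ℝ) ^ (-((Dmin T m : ℚ) : ℝ)))⁻¹ := by
        refine prod_le_prod (fun i hi => ?_) (fun i hi => ?_)
        · have hi' : i < m := mem_range.1 hi
          have := M.rho215_lt_one (M.Dsum_succ_pos hi' (hpos (i + 1) hi'))
          exact inv_nonneg.2 (by linarith)
        · have hi' : i < m := mem_range.1 hi
          have hρ := rho215_leK G κ (Dmin_le_Dsum_succ G hκ hi' (hpos (i + 1) hi'))
          exact inv_anti₀ hq (by linarith)
    _ = ((1 - (G.L : ℝ) ^ (-((Dmin T m : ℚ) : ℝ)))⁻¹) ^ m := by rw [prod_const, card_range]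

end Uniform

/-! ## Relabeling along an ordering and the graphs `G′∗` of the integration by parts -/

section Relabel

variable (G : Counts V m) (κ : Fin m → ℚ)

/-- Relabeling the lines along an ordering l̃ = σ carries the extra exponents along: the generalized graph of
`relabelCounts G σ` with `κ ∘ σ` has the line dimensions of `G.toModelK κ` along σ. [cite: Balaban1983Higgs3, (2.7) p.425] -/
theorem toModelK_relabel_a (σ : Equiv.Perm (Fin m)) (i : Fin m) :
    ((relabelCounts G σ).toModelK (κ ∘ σ)).a i = (G.toModelK κ).a (σ i) := rfl

variable {S : Finset (Fin m)}

/-- **The line dimensions of `G′∗_c` over the generalized model**: the moved dimensions of p19's `toModel_a_moveCounts` plus the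
unchanged extra exponents. [cite: Balaban1983Higgs3, (2.9) p.425] -/
theorem toModelK_a_moveCounts (hS : ∀ l ∈ S, 1 ≤ G.diffOn (G.src l) l) (c : Fin m → Option (Fin m)) (p : Fin m) :
    ((moveCounts G S c).toModelK κ).a p = (G.toModelK κ).a p + (if p ∈ S then 1 else 0) - (nHit S c p : ℝ) := by
  rw [toModelK_a, toModelK_a, toModel_a_moveCounts G hS c p]
  ring

/-- **Degrees over the generalized model do not decrease under (2.8)/(2.9), and single-site blocks gain `+1`.**
[cite: Balaban1983Higgs3, (2.9) p.425] -/
theorem DK_moveCounts_ge (hS : S ⊆ sites G) {c : Fin m → Option (Fin m)} (hc : c ∈ choices G.src G.tgt S) (i : ℕ) (b : V) :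
    (G.toModelK κ).D i b + (if ∃ l ∈ S, G.toModel.before i b = {l} then 1 else 0)
      ≤ ((moveCounts G S c).toModelK κ).D i b := by
  rw [D_toModelK, D_toModelK, moveCounts_before]
  have := D_moveCounts_ge G hS hc i b
  linarith

/-- **All blocks of every `G′∗_c` over the generalized model have positive degree** under the printed hypothesis of
Proposition 2.1 read with the generalized (2.4)-blocks `Is24K` (p. 426: *"for each graph G′∗ the subgraphs G₁, G₂, …, G_m =
G′∗ defined as previously have positive degrees"*). [cite: Balaban1983Higgs3, Prop. 2.1 p.426] -/
theorem posK_moveCounts {c : Fin m → Option (Fin m)} (hc : c ∈ choices G.src G.tgt (sites G))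
    (hyp : ∀ i, i ≤ m → ∀ b ∈ (G.toModelK κ).reps i, (G.toModelK κ).Nontriv i b →
      Is24K G κ i b ∨ 0 < (G.toModelK κ).D i b) :
    ∀ i, i ≤ m → ∀ b ∈ ((moveCounts G (sites G) c).toModelK κ).reps i,
      ((moveCounts G (sites G) c).toModelK κ).Nontriv i b → 0 < ((moveCounts G (sites G) c).toModelK κ).D i b := by
  intro i hi b hb hn
  rw [reps_toModelK, moveCounts_reps, ← reps_toModelK G κ] at hb
  rw [nontriv_toModelK, moveCounts_nontriv, ← nontriv_toModelK G κ] at hn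
  have hge := DK_moveCounts_ge G κ (subset_refl (sites G)) hc i b
  rcases hyp i hi b hb hn with h24 | hpos
  · obtain ⟨l, hl, hB⟩ := h24.1.exists_site
    rw [if_pos ⟨l, hl, hB⟩, h24.D_eq_zero] at hge
    linarith
  · have : (0 : ℝ) ≤ (if ∃ l ∈ sites G, G.toModel.before i b = {l} then 1 else 0) := by split_ifs <;> norm_num
    linarith

end Relabel

end B3FreeLine

end Literature.MathematicalPhysics.QuantumFieldTheory.Balaban1983to89
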